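import Mathlib
import Summits.MatrixMultiplication.MatrixMultiplication.Theses.HiddenToeplitzCorners
import Literature.Computability.AlgebraicComplexity.ArithCircuitProofs
import Literature.Computability.AlgebraicComplexity.MatMulTotalComplexityProofs
import Literature.Computability.AlgebraicComplexity.FastFourierTransform
import Literature.Computability.AlgebraicComplexity.DivisionSLP
import Literature.LinearAlgebra.Matrix.CauchyDeterminant
import Literature.LinearAlgebra.Matrix.CauchyLike
import Summits.MatrixMultiplication.MatrixMultiplication.Theorems.HiddenToeplitzCornersToeplitzLikeDetCostPairs
import Summits.MatrixMultiplication.MatrixMultiplication.Theorems.HiddenToeplitzCornersToeplitzLikeDetCostPolyMulCost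
import Summits.MatrixMultiplication.MatrixMultiplication.Theorems.HiddenToeplitzCornersToeplitzLikeDetCostCauchyMatvec
import Summits.MatrixMultiplication.MatrixMultiplication.Theorems.HiddenToeplitzCornersToeplitzLikeDetCostCauchyAlgebra
import Summits.MatrixMultiplication.MatrixMultiplication.Theorems.HiddenToeplitzCornersToeplitzLikeDetCostFFTCost
import Summits.MatrixMultiplication.MatrixMultiplication.Theorems.HiddenToeplitzCornersToeplitzLikeDetCostMBA
import Summits.MatrixMultiplication.MatrixMultiplication.Theorems.HiddenToeplitzCornersToeplitzLikeDetCostConversion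
import Summits.MatrixMultiplication.MatrixMultiplication.Theorems.HiddenToeplitzCornersToeplitzLikeDetCostNormalise
import Summits.MatrixMultiplication.MatrixMultiplication.Theorems.HiddenToeplitzCornersToeplitzLikeDetCostEvalTransfer
import Summits.MatrixMultiplication.MatrixMultiplication.Theorems.HiddenToeplitzCornersToeplitzLikeDetCostPencilPad1
import Summits.MatrixMultiplication.MatrixMultiplication.Theorems.HiddenToeplitzCornersToeplitzLikeDetCostPencilPad2
import Summits.MatrixMultiplication.MatrixMultiplication.Theorems.HiddenToeplitzCornersToeplitzLikeDetCostCoreAux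
import Summits.MatrixMultiplication.MatrixMultiplication.Theorems.HiddenToeplitzCornersToeplitzLikeDetCostFinal

/-!
# `HiddenToeplitzCorners.ToeplitzLikeDetCost` (stmt-MatrixMultiplication-7491):
# ω-free superfast elimination, division-free output form — PROVED

Route `MatrixMultiplication/HiddenToeplitzCorners`, crux (rank 3; the route's one remaining unproved
literature input since the cone repair of 2026-08-15): for every `ε > 0` and all large `r`, every
pencil `T(X) = ∑ X_ab T_ab` of `N × N` complex matrices, `N ≤ r³`, given with split Stein
generators `T_ab − Z T_ab Zᵀ = G₀ (H₁)_abᵀ + (G₁)_ab H₀ᵀ` of length `d` and sparsity `s`, admits a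
nonzero polynomial `Q` with `complexity (Q · det T(X)) ≤ (d²N + s) · r^ε`.

This file proves the last stub `stub_core` (the non-degenerate case with explicit constants,
via `core_finish` and the landed `…CoreAux`) and composes line `Sketch` (lead `prover-line-stmt-MatrixMultiplication-7491-0`,
skeleton `Cruxes/ToeplitzLikeDetCost/Lines/Sketch.lean`); the mathematics lives in the seventeen
landed helper files `HiddenToeplitzCornersToeplitzLikeDetCost*.lean`:

* polynomial level `R = ℂ[X]`: `…Pairs` (Strassen 1973 numerator/denominator simulation of a
  computation WITH division over `K = Frac R` by a division-free circuit of four times the length),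
  `…PencilPad1/2` (nilpotent Stein operator, identity-first padding with free generators, the
  pencil's Stein equation, the linear-form program of length `s`, evaluation), `…EvalTransfer`
  (`R → K` transfer of principal minors; Cauchy matrices are nonsingular), `…Final` (degenerate
  cases and the `ε`-bookkeeping);
* field level (abstract `K ⊇ ℂ`, cost predicate `Derivable` of `Literature/…/DivisionSLP.lean`):
  `…FFTCost` (radix-2 FFT, `κ 2^κ`), `…PolyMulCost` (fast products), `…CauchyMatvec` (Cauchy-like
  matvecs on twisted root-of-unity coset grids: diagonal × circulant × diagonal), `…CauchyAlgebra`
  (GKO95 Lemma 1.1: Schur complements / inverses of Cauchy-like matrices), `…MBAAux`, `…MBA`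
  (Morf / Bitmead–Anderson divide and conquer in Cauchy-like form, `O(α² N log² N)`),
  `…ConversionAux`, `…ConversionAuxDFT`, `…Conversion` (Toeplitz-like ↦ Cauchy-like by twisted
  DFTs), `…Normalise` (free-constant normalisation to a plain Cauchy matrix at one point `X₀`),
  `…CoreAux` (Stein-equation transport, entries of the padded generators, cost arithmetic, and the
  elimination end-game `core_elim`); here: `core_finish`, `stub_core` (constants
  `10⁴ (d+1)² (log₂N+2)² 2^(log₂N+1)`) and the composition `ToeplitzLikeDetCost_of`.

No named facts are assumed: the result is unconditional (axioms `propext`, `Classical.choice`,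
`Quot.sound`).
-/

set_option linter.dupNamespace false

namespace Summit.MatrixMultiplication.MatrixMultiplication.Theorems

open scoped BigOperators Matrix
open Literature.Computability.AlgebraicComplexity Literature.LinearAlgebra.Matrix
open Literature.Computability.AlgebraicComplexity.ArithCircuit (FanInTwoSeq freeInputs)
open Summit.MatrixMultiplication.MatrixMultiplication.Theses.HiddenToeplitzCorners (ToeplitzLikeDetCost)

noncomputable section

/-- **The core, after conversion.** Given the converted pencil `C₀ = cauchyLike x y G₃ H₃ =
V₁ · T_R · V₂⁻¹` over `K = Frac ℂ[X]` and its constant counterpart at a point `x₀`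
(`B₀ = V₁ · T_R(x₀) · V₂⁻¹ = cauchyLike x y G₃₀ H₃₀`, `det T_R(x₀) ≠ 0`), normalise
(`stub_normalise`) and finish with `core_elim`. [cite: Pan2001, Cor. 5.3.3] -/
theorem core_finish {r : ℕ} (κ : ℕ) {ω : ℂ} (hω : IsPrimitiveRoot ω (2 ^ κ)) {N : ℕ}
    (TX : Matrix (Fin N) (Fin N) (MvPolynomial (Fin r × Fin r) ℂ))
    (TR : Matrix (Fin (2 ^ κ)) (Fin (2 ^ κ)) (MvPolynomial (Fin r × Fin r) ℂ)) (hdetTR : TR.det = TX.det)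
    (x0 : Fin r × Fin r → ℂ) (hT0 : (TR.map (MvPolynomial.eval x0)).det ≠ 0)
    (V₁ V₂ : Matrix (Fin (2 ^ κ)) (Fin (2 ^ κ)) ℂ) (hV₁ : IsUnit V₁.det) (hV₂ : IsUnit V₂.det)
    {p₃ : Type} [Fintype p₃] [DecidableEq p₃]
    {G₃ H₃ : Matrix (Fin (2 ^ κ)) p₃ (FractionRing (MvPolynomial (Fin r × Fin r) ℂ))}
    (hC0 : (cauchyLike (fun i : Fin (2 ^ κ) => algebraMap ℂ (FractionRing (MvPolynomial (Fin r × Fin r) ℂ)) (1 * ω ^ (i : ℕ))) (fun j : Fin (2 ^ κ) => algebraMap ℂ (FractionRing (MvPolynomial (Fin r × Fin r) ℂ)) (2 * ω ^ (j : ℕ))) G₃ H₃) =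
      V₁.map (algebraMap ℂ (FractionRing (MvPolynomial (Fin r × Fin r) ℂ))) * TR.map (algebraMap (MvPolynomial (Fin r × Fin r) ℂ) (FractionRing (MvPolynomial (Fin r × Fin r) ℂ))) * (V₂.map (algebraMap ℂ (FractionRing (MvPolynomial (Fin r × Fin r) ℂ))))⁻¹)
    {G₃₀ H₃₀ : Matrix (Fin (2 ^ κ)) p₃ ℂ}
    (hB0 : cauchyLike (fun i : Fin (2 ^ κ) => (1 : ℂ) * ω ^ (i : ℕ)) (fun j : Fin (2 ^ κ) => (2 : ℂ) * ω ^ (j : ℕ)) G₃₀ H₃₀ = V₁ * TR.map (MvPolynomial.eval x0) * V₂⁻¹)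
    (l : List (MvPolynomial (Fin r × Fin r) ℂ)) (hl : FanInTwoSeq (freeInputs ℂ (Fin r × Fin r)) l) (c₆ : ℕ)
    (hD6 : Derivable ℂ c₆ ((algebraMap (MvPolynomial (Fin r × Fin r) ℂ) (FractionRing (MvPolynomial (Fin r × Fin r) ℂ))) '' (freeInputs ℂ (Fin r × Fin r) ∪ {x | x ∈ l}))
      (Set.range (fun ik : Fin (2 ^ κ) × p₃ => G₃ ik.1 ik.2) ∪ Set.range (fun ik : Fin (2 ^ κ) × p₃ => H₃ ik.1 ik.2))) :
    ∃ Q : (MvPolynomial (Fin r × Fin r) ℂ), Q ≠ 0 ∧ complexity (Q * TX.det) ≤ l.length +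
      4 * (c₆ + 2 * Fintype.card p₃ * (Fintype.card p₃ + 1) * (2 * κ + 7) * 2 ^ κ +
        64 * (Fintype.card ((Fin 1 ⊕ p₃) ⊕ p₃) + 1) ^ 2 * (κ + 1) ^ 2 * 2 ^ κ) := by
  classical
  -- the constant matrix `B₀ = V₁ T(x₀) V₂⁻¹` is invertible
  set B₀ : Matrix (Fin (2 ^ κ)) (Fin (2 ^ κ)) ℂ := V₁ * TR.map (MvPolynomial.eval x0) * V₂⁻¹ with hB₀def
  have hB₀det : IsUnit B₀.det := by
    rw [hB₀def, Matrix.det_mul, Matrix.det_mul]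
    exact (hV₁.mul (isUnit_iff_ne_zero.2 hT0)).mul (Matrix.isUnit_nonsing_inv_det V₂ hV₂)
  -- normalisation, then elimination
  obtain ⟨hCK, hD7⟩ := stub_normalise (K := (FractionRing (MvPolynomial (Fin r × Fin r) ℂ))) κ ω hω p₃ G₃ H₃ B₀ G₃₀ H₃₀ hB0.symm hB₀det
  exact core_elim κ hω TX TR hdetTR x0 V₁ V₂ hV₁ hV₂ hC0 B₀ hB₀def hB₀det hCK _ hD7 l hl c₆ hD6

/-- **Stub `core`** — see `Lines/Sketch.lean`. [cite: Pan2001, Cor. 5.3.3] -/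
theorem stub_core :
    ∀ (r N d : ℕ) (T : Fin r → Fin r → Matrix (Fin N) (Fin N) ℂ) (G₀ H₀ : Matrix (Fin N) (Fin d) ℂ) (G₁ H₁ : Fin r → Fin r → Matrix (Fin N) (Fin d) ℂ),
      (∀ a b, T a b - (Matrix.of fun i j : Fin N => if (i : ℕ) = (j : ℕ) + 1 then (1 : ℂ) else 0) * T a b * (Matrix.of fun i j : Fin N => if (i : ℕ) = (j : ℕ) + 1 then (1 : ℂ) else 0)ᵀ = G₀ * (H₁ a b)ᵀ + G₁ a b * H₀ᵀ) →
      0 < N → 0 < d → (∃ X₀ : Matrix (Fin r) (Fin r) ℂ, (∑ a : Fin r, ∑ b : Fin r, X₀ a b • T a b).det ≠ 0) →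
      ∃ Q : MvPolynomial (Fin r × Fin r) ℂ, Q ≠ 0 ∧
        complexity (Q * (∑ a : Fin r, ∑ b : Fin r, (MvPolynomial.X (a, b) : MvPolynomial (Fin r × Fin r) ℂ) • (T a b).map (MvPolynomial.C : ℂ → MvPolynomial (Fin r × Fin r) ℂ)).det) ≤
          (∑ a : Fin r, ∑ b : Fin r, ((Finset.univ.filter fun p : Fin N × Fin d => G₁ a b p.1 p.2 ≠ 0).card + (Finset.univ.filter fun p : Fin N × Fin d => H₁ a b p.1 p.2 ≠ 0).card)) +
          4 * (10000 * (d + 1) ^ 2 * (Nat.log 2 N + 2) ^ 2 * 2 ^ (Nat.log 2 N + 1)) := by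
  intro r N d T G₀ H₀ G₁ H₁ hStein hN _hd hX
  obtain ⟨X₀, hX₀⟩ := hX
  classical
  -- sizes: pad to `2^κ`, `κ = log₂ N + 1`
  set κ := Nat.log 2 N + 1 with hκdef
  have hNn : N ≤ 2 ^ κ := (Nat.lt_pow_succ_log_self Nat.one_lt_two N).le
  -- a primitive `2^κ`-th root of unity and the grids `⟨ω⟩`, `2⟨ω⟩`
  set ω : ℂ := Complex.exp (2 * Real.pi * Complex.I / ((2 ^ κ : ℕ) : ℂ))
  have hω : IsPrimitiveRoot ω (2 ^ κ) := Complex.isPrimitiveRoot_exp (2 ^ κ) (by positivity)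
  have h12 : ‖(1 : ℂ)‖ ≠ ‖(2 : ℂ)‖ := by norm_num
  have hsep12 : ∀ i j : ℕ, (1 : ℂ) * ω ^ i ≠ 2 * ω ^ j := fun i j => coset_nodes_ne hω h12 i j
  -- the pencil over `R = ℂ[X]`: Stein equation, padding, linear-form program, evaluation
  obtain ⟨hP3, hP4, hP5⟩ := stub_pencilPad2
  obtain ⟨-, hP2⟩ := stub_pencilPad1
  have hSteinR := hP3 r N d T G₀ H₀ G₁ H₁ hStein
  obtain ⟨hPadR, hdetTR⟩ := hP2 (MvPolynomial (Fin r × Fin r) ℂ) N (2 ^ κ) hNn (Fin d ⊕ Fin d) _ _ _ hN hSteinR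
  obtain ⟨l, hl, hlen, hG1X, hH1X⟩ := hP4 r N d T G₀ H₀ G₁ H₁
  -- reindex the generator columns by `Fin β` and pass to `K = Frac R` and to `ℂ` (at `X₀`)
  set eβ := Fintype.equivFin ((Fin 1 ⊕ Fin 1) ⊕ (Fin d ⊕ Fin d))
  have hPadRβ := core_stein_reindex eβ hPadR
  have hSteinK := core_stein_map (algebraMap (MvPolynomial (Fin r × Fin r) ℂ) (FractionRing (MvPolynomial (Fin r × Fin r) ℂ))) hPadRβ
  set x0 : Fin r × Fin r → ℂ := fun p => X₀ p.1 p.2 with hx0def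
  have hStein0 := core_stein_map (MvPolynomial.eval x0) hPadRβ
  -- conversion at `K` and at `ℂ`
  obtain ⟨-, -, hC0K, hcostK⟩ := stub_conversion (K := (FractionRing (MvPolynomial (Fin r × Fin r) ℂ))) (fftCost (K := (FractionRing (MvPolynomial (Fin r × Fin r) ℂ))))
    (stub_polyMulCost (K := (FractionRing (MvPolynomial (Fin r × Fin r) ℂ))) (fftCost (K := (FractionRing (MvPolynomial (Fin r × Fin r) ℂ))))) κ _ ω 1 2 hω one_ne_zero two_ne_zero
    hsep12 _ _ _ hSteinK
  obtain ⟨hV1C, hV2C, hB0C, -⟩ := stub_conversion (K := ℂ) (fftCost (K := ℂ))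
    (stub_polyMulCost (K := ℂ) (fftCost (K := ℂ))) κ _ ω 1 2 hω one_ne_zero two_ne_zero
    hsep12 _ _ _ hStein0
  simp only [Algebra.algebraMap_self, RingHom.id_apply] at hV1C hV2C hB0C
  -- the twisted DFTs over `K` are the `ℂ`-ones mapped
  have hV1 : (Matrix.of fun i j : Fin (2 ^ κ) => algebraMap ℂ (FractionRing (MvPolynomial (Fin r × Fin r) ℂ)) ((1 : ℂ) ^ (j : ℕ) * ω ^ ((i : ℕ) * j))) =
      (Matrix.of fun i j : Fin (2 ^ κ) => (1 : ℂ) ^ (j : ℕ) * ω ^ ((i : ℕ) * j)).map (algebraMap ℂ (FractionRing (MvPolynomial (Fin r × Fin r) ℂ))) := by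
    ext i j; rfl
  have hV2 : (Matrix.of fun i j : Fin (2 ^ κ) => algebraMap ℂ (FractionRing (MvPolynomial (Fin r × Fin r) ℂ)) ((2 : ℂ) ^ (j : ℕ) * ω ^ ((i : ℕ) * j))) =
      (Matrix.of fun i j : Fin (2 ^ κ) => (2 : ℂ) ^ (j : ℕ) * ω ^ ((i : ℕ) * j)).map (algebraMap ℂ (FractionRing (MvPolynomial (Fin r × Fin r) ℂ))) := by
    ext i j; rfl
  rw [hV1, hV2] at hC0K hcostK
  -- the generator entries over `K` are inputs or constants
  set A₀ : Set (FractionRing (MvPolynomial (Fin r × Fin r) ℂ)) := (algebraMap (MvPolynomial (Fin r × Fin r) ℂ) (FractionRing (MvPolynomial (Fin r × Fin r) ℂ))) '' (freeInputs ℂ (Fin r × Fin r) ∪ {x | x ∈ l})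
  have hconst : ∀ c : ℂ, algebraMap (MvPolynomial (Fin r × Fin r) ℂ) (FractionRing (MvPolynomial (Fin r × Fin r) ℂ)) (MvPolynomial.C c) ∈ A₀ ∪ Set.range (algebraMap ℂ (FractionRing (MvPolynomial (Fin r × Fin r) ℂ))) := by
    intro c
    refine Or.inr ⟨c, ?_⟩
    rw [IsScalarTower.algebraMap_apply ℂ (MvPolynomial (Fin r × Fin r) ℂ) (FractionRing (MvPolynomial (Fin r × Fin r) ℂ)) c, MvPolynomial.algebraMap_eq]
  have h0mem : (0 : (FractionRing (MvPolynomial (Fin r × Fin r) ℂ))) ∈ A₀ ∪ Set.range (algebraMap ℂ (FractionRing (MvPolynomial (Fin r × Fin r) ℂ))) := Or.inr ⟨0, by simp⟩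
  have h1mem : (1 : (FractionRing (MvPolynomial (Fin r × Fin r) ℂ))) ∈ A₀ ∪ Set.range (algebraMap ℂ (FractionRing (MvPolynomial (Fin r × Fin r) ℂ))) := Or.inr ⟨1, by simp⟩
  have hD6 := hcostK A₀
    (fun i k => by
      rw [Matrix.map_apply, Matrix.submatrix_apply]
      refine core_padP_induct hNn _ i (eβ.symm k)
        (fun v => algebraMap (MvPolynomial (Fin r × Fin r) ℂ) (FractionRing (MvPolynomial (Fin r × Fin r) ℂ)) v ∈ A₀ ∪ Set.range (algebraMap ℂ (FractionRing (MvPolynomial (Fin r × Fin r) ℂ)))) ?_ ?_ ?_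
      · rw [map_zero]; exact h0mem
      · rw [map_one]; exact h1mem
      · intro i' kk
        rcases kk with kk | kk
        · rw [Matrix.fromCols_apply_inl, Matrix.map_apply]; exact hconst _
        · rw [Matrix.fromCols_apply_inr]; exact Or.inl (Set.mem_image_of_mem _ (hG1X i' kk)))
    (fun i k => by
      rw [Matrix.map_apply, Matrix.submatrix_apply]
      refine core_padQ_induct hNn _ i (eβ.symm k)
        (fun v => algebraMap (MvPolynomial (Fin r × Fin r) ℂ) (FractionRing (MvPolynomial (Fin r × Fin r) ℂ)) v ∈ A₀ ∪ Set.range (algebraMap ℂ (FractionRing (MvPolynomial (Fin r × Fin r) ℂ)))) ?_ ?_ ?_ ?_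
      · rw [map_zero]; exact h0mem
      · rw [map_one]; exact h1mem
      · rw [map_neg, map_one]; exact Or.inr ⟨-1, by simp⟩
      · intro i' kk
        rcases kk with kk | kk
        · rw [Matrix.fromCols_apply_inl]; exact Or.inl (Set.mem_image_of_mem _ (hH1X i' kk))
        · rw [Matrix.fromCols_apply_inr, Matrix.map_apply]; exact hconst _)
  obtain ⟨Q, hQ, hQc⟩ := core_finish κ hω _ _ hdetTR x0 (by
      rw [← RingHom.mapMatrix_apply, ← RingHom.map_det, hdetTR, RingHom.map_det,
        RingHom.mapMatrix_apply, hP5 r (Fin N) (Fin N) T x0]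
      simpa [hx0def] using hX₀) _ _ hV1C hV2C hC0K hB0C l hl _ hD6
  refine ⟨Q, hQ, hQc.trans ?_⟩
  -- bookkeeping
  have hk : Nat.log 2 N + 2 = κ + 1 := by omega
  rw [hk]
  have hb : Fintype.card ((Fin 1 ⊕ Fin 1) ⊕ (Fin d ⊕ Fin d)) = 2 * d + 2 := by
    simp only [Fintype.card_sum, Fintype.card_fin]; omega
  have hp3 : Fintype.card ((Fin 1 ⊕ Fin 1) ⊕ Fin (Fintype.card ((Fin 1 ⊕ Fin 1) ⊕ (Fin d ⊕ Fin d)))) =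
      Fintype.card ((Fin 1 ⊕ Fin 1) ⊕ (Fin d ⊕ Fin d)) + 2 := by
    simp only [Fintype.card_sum, Fintype.card_fin]; omega
  have hpC : Fintype.card ((Fin 1 ⊕ ((Fin 1 ⊕ Fin 1) ⊕ Fin (Fintype.card ((Fin 1 ⊕ Fin 1) ⊕ (Fin d ⊕ Fin d))))) ⊕
      ((Fin 1 ⊕ Fin 1) ⊕ Fin (Fintype.card ((Fin 1 ⊕ Fin 1) ⊕ (Fin d ⊕ Fin d))))) =
      1 + Fintype.card ((Fin 1 ⊕ Fin 1) ⊕ Fin (Fintype.card ((Fin 1 ⊕ Fin 1) ⊕ (Fin d ⊕ Fin d)))) +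
        Fintype.card ((Fin 1 ⊕ Fin 1) ⊕ Fin (Fintype.card ((Fin 1 ⊕ Fin 1) ⊕ (Fin d ⊕ Fin d)))) := by
    simp only [Fintype.card_sum, Fintype.card_fin]
  have harith := core_arith' d κ _ _ _ hb hp3 hpC
  exact Nat.add_le_add hlen (Nat.mul_le_mul_left 4 harith)


/-- **`ToeplitzLikeDetCost` holds** (crux stmt-MatrixMultiplication-7491 of route
`HiddenToeplitzCorners`): ω-free superfast elimination on Toeplitz-like pencils in division-free
output form — `stub_final` (degenerate cases, asymptotics) applied to `stub_core` (padding,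
Toeplitz→Cauchy conversion, free-constant normalisation, superfast Cauchy-like elimination over
`Frac ℂ[X]`, numerator/denominator pairs), the nilpotency of the Stein operator and entrywise
evaluation of pencils. [cite: Pan2001, Cor. 5.3.3] -/
theorem ToeplitzLikeDetCost_of : ToeplitzLikeDetCost :=
  stub_final stub_core stub_pencilPad1.1 stub_pencilPad2.2.2

end

end Summit.MatrixMultiplication.MatrixMultiplication.Theorems
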